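import Mathlib.Algebra.BigOperators.Group.Finset.Basic
import Mathlib.Algebra.Order.BigOperators.Group.Finset
import Mathlib.Data.Rat.Defs
import Mathlib.Tactic

/-!
# PercRepro — THE ABSTRACT CHARGING LEMMA (night-1, gen 9 session 4; dossier §19.12 (b))

An equal-split charging never gives out more than the total weight: for finsets `A` (receivers) and `T` (suppliers),
a relation `R`, and non-negative weights `w`, `Σ_{a ∈ A} Σ_{t ∈ T, R a t} w t / #{a′ ∈ A : R a′ t} ≤ Σ_{t ∈ T} w t`
(`sum_charge_le_sum_weight`).  Used twice in the assembly of the averaged (MC): once for the independent supply sets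
(`R a t = t ⊆ a`) and once for the dependent ones (`R a t = E ∖ a ⊆ t`).

Axioms: standard.
-/

namespace PercRepro

open Finset

/-- **THE CHARGING LEMMA**: an equal split gives out at most the weight of every supplier. -/
theorem sum_charge_le_sum_weight {ι κ : Type} (A : Finset ι) (T : Finset κ) (R : ι → κ → Prop)
    [∀ a t, Decidable (R a t)] (w : κ → ℚ) (hw : ∀ t ∈ T, 0 ≤ w t) :
    ∑ a ∈ A, ∑ t ∈ T.filter (fun t => R a t), w t / ((A.filter (fun a' => R a' t)).card : ℚ) ≤
      ∑ t ∈ T, w t := by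
  -- swap the sums
  have hswap : ∑ a ∈ A, ∑ t ∈ T.filter (fun t => R a t), w t / ((A.filter (fun a' => R a' t)).card : ℚ) =
      ∑ t ∈ T, ∑ a ∈ A.filter (fun a' => R a' t), w t / ((A.filter (fun a' => R a' t)).card : ℚ) := by
    simp only [Finset.sum_filter]
    exact Finset.sum_comm
  rw [hswap]
  refine Finset.sum_le_sum (fun t ht => ?_)
  rw [Finset.sum_const, nsmul_eq_mul]
  by_cases h : (A.filter (fun a' => R a' t)).card = 0
  · rw [h]; simp only [Nat.cast_zero, zero_mul]; exact hw t ht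
  · have hpos : (0 : ℚ) < ((A.filter (fun a' => R a' t)).card : ℚ) := by
      exact_mod_cast Nat.pos_of_ne_zero h
    rw [mul_div_cancel₀ _ hpos.ne']

end PercRepro
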